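import Summits.Schanuel.Schanuel.Theses.RigidCore
import Literature.NumberTheory.Transcendental.ExpPointsExamples
import Literature.NumberTheory.Transcendental.SchneiderCuspGerm

/-!
# Zero lower log-density of the integer points of a transcendental cusp germ
(stub `stub_cuspZeroLogDensity`, Theorem S of the line `cusp-germ-schneider-sparsity`)

Crux `RigidCore.SparsityTwo` (item stmt-Schanuel-0971), composition `SparsityTwo_of_statements`,
branch "real, non-rational jet": this stub supplies the LACUNARITY of the integer points that the
residual stub (★) consumes.

What. For `e ≥ 1`, a jet `A ∈ ℂ[w]` and a tail `g` analytic at `0` (with `g 0 = 0`) that is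
TRANSCENDENTAL over `ℂ(z)` (no non-zero `P ∈ ℂ[X, Y]` with `P(z, g z) = 0` near `0`), the set
`S = {N : A(N^{1/e}) + g(N^{-1/e}) ∈ ℤ}` has zero lower logarithmic density, junk-free:
`∀ ε > 0, ∃ᶠ X, #(S ∩ [0, X]) ≤ ε log X`.

Source. Schneider's integer-valued-function method in Pólya form (Schneider 1949; Waldschmidt
1978), with the accumulation of the sample points `σ_N = N^{-1/e}` at the cusp replacing the
arithmetic anchor; carried out in full generality `(e, d = deg A)` in the tree file
`Literature.NumberTheory.Transcendental.SchneiderCuspGerm` (theorem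
`frequently_card_le_mul_log`, with its support files `SchneiderCuspAuxPoly` — the auxiliary
polynomial and its non-vanishing, `SchneiderCuspCounting` — the near-record-low scale and the two
phase inequalities (`κ = λ = 1/(8(e+d))`: `D = 8(e+d)k`, `T = (e+d)D`, `m = D²/2` equations,
audited for all `(e, d)`), `SchneiderCuspExtrapolation` and `Literature.Analysis.Complex.
DiscZeroDivision` — the crude Schwarz lemma on a disc, `SchneiderCuspEngine` — Siegel's lemma
and the extrapolation induction).

Design. This file is the one-line specialisation; the hypothesis `g 0 = 0` of the registered
signature is not needed by the proof (it is a normalisation of the composition) and is discarded.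
-/

namespace Summit.Schanuel.Schanuel.Cruxes.SparsityTwo.CuspGermSchneiderSparsity

open Filter Topology Complex Polynomial Literature.NumberTheory.Transcendental
open scoped Real

/-- **Theorem S** (stub `stub_cuspZeroLogDensity` of the line `cusp-germ-schneider-sparsity`):
for `e ≥ 1`, any jet `A ∈ ℂ[w]` and a tail `g` analytic at `0`, `g 0 = 0`, transcendental over
`ℂ(z)`, the integer points `{N : A(N^{1/e}) + g(N^{-1/e}) ∈ ℤ}` have zero lower logarithmic
density: `∀ ε > 0, ∃ᶠ X, #{N ≤ X : hit} ≤ ε log X`. Immediate from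
`Literature.NumberTheory.Transcendental.frequently_card_le_mul_log`. -/
theorem stub_cuspZeroLogDensity :
    ∀ (e : ℕ), 0 < e → ∀ (A : Polynomial ℂ) (g : ℂ → ℂ), AnalyticAt ℂ g 0 → g 0 = 0 →
      (¬ ∃ P : MvPolynomial (Fin 2) ℂ, P ≠ 0 ∧
          ∀ᶠ z in 𝓝 (0 : ℂ), MvPolynomial.eval ![z, g z] P = 0) →
      ∀ ε : ℝ, 0 < ε → ∃ᶠ X : ℕ in atTop,
        (Nat.card {N : ℕ | N ≤ X ∧ ∃ L : ℤ,
            A.eval ((((N : ℝ) ^ ((e : ℝ)⁻¹) : ℝ) : ℂ)) +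
              g ((((N : ℝ) ^ ((e : ℝ)⁻¹) : ℝ) : ℂ))⁻¹ = L} : ℝ) ≤ ε * Real.log X := by
  intro e he A g hg _ htr ε hε
  exact frequently_card_le_mul_log e he A g hg htr ε hε

end Summit.Schanuel.Schanuel.Cruxes.SparsityTwo.CuspGermSchneiderSparsity
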